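import Mathlib
import Summits.KontsevichZagierPeriods.KontsevichZagierPeriods.Theses.InverseLandau
import Literature.NumberTheory.Transcendental.KZLogCalculusProofs
import Literature.NumberTheory.Transcendental.KZProductIdeal
import Literature.NumberTheory.Transcendental.KZSemialgebraicComplex
import Literature.NumberTheory.Transcendental.GammaMonomialsProofs
import Summits.KontsevichZagierPeriods.KontsevichZagierPeriods.Theorems.InverseLandauTateLiftingAffineChart

/-!
# `TateLifting` (stmt-KontsevichZagierPeriods-9129), line `Sketch` — stub `CoxeterChamberTiling`:
# the Coxeter chamber of the four-ball is one `324`-th of the ball INSIDE THE RULES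

Item stmt-KontsevichZagierPeriods-3818 `CoxeterChamberTiling` of route `SphericalSchlafli`, verbatim.
In `ℝ⁴ = ℝ² × ℝ²` let `W = {(p, q) | 0 ≤ q, 0 ≤ sin(π/9)·p − cos(π/9)·q}` be the closed wedge of opening
angle `π/9` and `B⁴` the closed unit ball. For honest representations `r = [B⁴ ∩ (W × W), 1]`,
`b = [B⁴, 1]` we prove `324 • [r] − [b] ∈ KZ.relations` by the moves, with no volume computation. In
the plane `(v 0, v 1)` the wedge `W_{α,β}` of directions `[α, β]` (`β − α ≤ π`) is
`{0 ≤ cos α · v 1 − sin α · v 0} ∩ {0 ≤ sin β · v 0 − cos β · v 1}`; `W_β := W_{0,β}`.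

* `CoxeterChamber.exists_split` — RULE (1) along the wall `{sin γ · v 0 = cos γ · v 1}` (real-algebraic
  normal; a hyperplane, Lebesgue-null: `CoxeterChamber.volume_wall`);
* `CoxeterChamber.exists_rotate` — RULE (2): for `σ ⊆ ℝ⁴` invariant under the rotations of the plane
  `(v 0, v 1)` and `cos α`, `sin α` real-algebraic, `[W_β ∩ σ, 1] ≡ [W_{α,α+β} ∩ σ, 1]`, the honest
  pull-back along the rotation matrix `R_{−α} ⊕ 1` (the landed affine engine
  `AffineEngine.exists_pullback`; `det = cos² α + sin² α = 1`, angle addition formulas);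
* `CoxeterChamber.wedge_nsmul` — `m • [W_θ ∩ σ, 1] ≡ [W_{mθ} ∩ σ, 1]` for `mθ ≤ π` (induction: split
  `W_{(m+1)θ}` along the wall of direction `mθ`, rotate the upper piece back; the angular bookkeeping
  is the sine subtraction formula), and `CoxeterChamber.sector_nsmul` — `2n • [W_{π/n} ∩ σ, 1] ≡ [σ, 1]`
  (`n` wedges make the upper half-space, whose rotation by `π` is the lower one);
* `tateLifting_coxeterChamberTiling` — the sector count for `σ = B⁴ ∩ (ℝ² × W)`, the coordinate swap
  `(v 0, v 1, v 2, v 3) ↦ (v 2, v 3, v 0, v 1)` (`KZ.of_sub_of_reindex_mem_relations`), and the sector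
  count for `σ = B⁴`: `324 = 18 · 18` (`cos (kπ/9)`, `sin (kπ/9)` are real-algebraic,
  `KoblitzOgus.isAlgebraic_cos_rat_mul_pi`).

No definitions (pure proof file). References: M. Kontsevich, D. Zagier, *Periods* (2001), §1.2
rules (1), (2); H. S. M. Coxeter, *Discrete groups generated by reflections*, Ann. Math. 35 (1934).
-/

noncomputable section

open MeasureTheory Set
open Literature.NumberTheory.Transcendental
open Literature.ModelTheory.ExponentialFields (IsSemialgebraic)

namespace Summit.KontsevichZagierPeriods.InverseLandau

namespace CoxeterChamber

/-! ## Walls are null; splitting a representation along a wall (rule (1)) -/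

/-- The wall `{sin γ · v 0 = cos γ · v 1}` of `ℝ⁴` is Lebesgue-null (a proper linear subspace,
`Measure.addHaar_submodule`). [folklore] -/
theorem volume_wall (γ : ℝ) :
    volume {v : Fin 4 → ℝ | Real.sin γ * v 0 - Real.cos γ * v 1 = 0} = 0 := by
  let L : (Fin 4 → ℝ) →ₗ[ℝ] ℝ :=
    Real.sin γ • LinearMap.proj (R := ℝ) (φ := fun _ : Fin 4 => ℝ) 0 -
      Real.cos γ • LinearMap.proj (R := ℝ) (φ := fun _ : Fin 4 => ℝ) 1
  have hL : ∀ v, L v = Real.sin γ * v 0 - Real.cos γ * v 1 := fun v => rfl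
  rw [show {v : Fin 4 → ℝ | Real.sin γ * v 0 - Real.cos γ * v 1 = 0} =
    (LinearMap.ker L : Set (Fin 4 → ℝ)) from Set.ext fun v => by simp [hL]]
  refine Measure.addHaar_submodule volume (LinearMap.ker L) fun htop => ?_
  have hmem : (![Real.sin γ, -Real.cos γ, 0, 0] : Fin 4 → ℝ) ∈ LinearMap.ker L :=
    htop ▸ Submodule.mem_top
  rw [LinearMap.mem_ker, hL] at hmem
  simp only [Matrix.cons_val_zero, Matrix.cons_val_one] at hmem
  nlinarith [hmem, Real.sin_sq_add_cos_sq γ]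

/-- **Splitting along a wall** (rule (1)): for `cos γ`, `sin γ` real-algebraic, every representation
`R` of dimension `4` splits into its honest restrictions to `{0 ≤ sin γ · v 0 − cos γ · v 1}` and to
`{0 ≤ cos γ · v 1 − sin γ · v 0}` (same integrand; `ℚ`-semialgebraic pieces by graph elimination), the
overlap lying in the null wall. [cite: KontsevichZagier2001, §1.2 rule (1)] -/
theorem exists_split {γ : ℝ} (hc : IsAlgebraic ℚ (Real.cos γ)) (hs : IsAlgebraic ℚ (Real.sin γ))
    (R : KZ.IntegralRep 4) :
    ∃ R₁ R₂ : KZ.IntegralRep 4,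
      R₁.domain = {v | v ∈ R.domain ∧ 0 ≤ Real.sin γ * v 0 - Real.cos γ * v 1} ∧
      R₁.integrand = R.integrand ∧
      R₂.domain = {v | v ∈ R.domain ∧ 0 ≤ Real.cos γ * v 1 - Real.sin γ * v 0} ∧
      R₂.integrand = R.integrand ∧
      KZ.of R - KZ.of R₁ - KZ.of R₂ ∈ KZ.relations := by
  have hD := R.isSemialgebraic_domain
  have hf₁ : IsSemialgebraicFunOn ℚ R.domain (fun v => Real.sin γ * v 0 - Real.cos γ * v 1) :=
    IsSemialgebraicFunOn.sub_holds
      (IsSemialgebraicFunOn.mul_holds (isSemialgebraicFunOn_const_of_isAlgebraic hD hs)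
        (isSemialgebraicFunOn_apply hD 0))
      (IsSemialgebraicFunOn.mul_holds (isSemialgebraicFunOn_const_of_isAlgebraic hD hc)
        (isSemialgebraicFunOn_apply hD 1))
  have hf₂ : IsSemialgebraicFunOn ℚ R.domain (fun v => Real.cos γ * v 1 - Real.sin γ * v 0) :=
    hf₁.neg.congr fun v _ => by simp only [Pi.neg_apply]; ring
  have hS₁ := hf₁.isSemialgebraic_sep_nonneg
  have hS₂ := hf₂.isSemialgebraic_sep_nonneg
  refine ⟨R.restrict _ hS₁ (fun v hv => hv.1), R.restrict _ hS₂ (fun v hv => hv.1), rfl, rfl, rfl,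
    rfl, KZ.domainAddRel_subset_relations ⟨4, R, R.restrict _ hS₁ (fun v hv => hv.1),
      R.restrict _ hS₂ (fun v hv => hv.1), ?_, ?_, fun _ _ => rfl, fun _ _ => rfl, rfl⟩⟩
  · ext v
    simp only [KZ.IntegralRep.domain_restrict, mem_union, mem_setOf_eq]
    refine ⟨fun hv => ?_, fun hv => hv.elim (fun h => h.1) fun h => h.1⟩
    rcases le_total 0 (Real.sin γ * v 0 - Real.cos γ * v 1) with h | h
    · exact Or.inl ⟨hv, h⟩
    · exact Or.inr ⟨hv, by linarith⟩
  · simp only [KZ.IntegralRep.domain_restrict]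
    refine measure_mono_null (fun v hv => ?_) (volume_wall γ)
    simp only [mem_inter_iff, mem_setOf_eq] at hv ⊢
    linarith [hv.1.2, hv.2.2]

/-! ## Rotations of the plane `(v 0, v 1)` are rule-(2) moves -/

/-- **Rotation step** (rule (2)). Let `σ ⊆ ℝ⁴` be invariant under the rotations of the plane
`(v 0, v 1)`, `cos α`, `sin α` real-algebraic, and `r = [W_β ∩ σ, 1]`. The honest pull-back of `r` along
the rotation `R_{−α} ⊕ 1` (real-algebraic entries, determinant `cos² α + sin² α = 1`,
`AffineEngine.exists_pullback`) is a representation `[W_{α,α+β} ∩ σ, 1]` over the rotated wedge and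
differs from `r` by a relation. [cite: KontsevichZagier2001, §1.2 rule (2)] -/
theorem exists_rotate {σ : Set (Fin 4 → ℝ)}
    (hrot : ∀ v ∈ σ, ∀ c s : ℝ, c ^ 2 + s ^ 2 = 1 → ∀ w : Fin 4 → ℝ,
      w 0 = c * v 0 - s * v 1 → w 1 = s * v 0 + c * v 1 → w 2 = v 2 → w 3 = v 3 → w ∈ σ)
    {α β : ℝ} (hc : IsAlgebraic ℚ (Real.cos α)) (hs : IsAlgebraic ℚ (Real.sin α))
    (r : KZ.IntegralRep 4)
    (hr : r.domain = {v | 0 ≤ v 1 ∧ 0 ≤ Real.sin β * v 0 - Real.cos β * v 1} ∩ σ)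
    (hr1 : ∀ v ∈ r.domain, r.integrand v = 1) :
    ∃ q : KZ.IntegralRep 4,
      q.domain = {v | 0 ≤ Real.cos α * v 1 - Real.sin α * v 0 ∧
        0 ≤ Real.sin (α + β) * v 0 - Real.cos (α + β) * v 1} ∩ σ ∧
      (∀ v ∈ q.domain, q.integrand v = 1) ∧ KZ.of r - KZ.of q ∈ KZ.relations := by
  -- the rotation by `-α` of the plane `(v 0, v 1)`
  set A : Matrix (Fin 4) (Fin 4) ℝ := !![Real.cos α, Real.sin α, 0, 0; -Real.sin α, Real.cos α, 0, 0;
    0, 0, 1, 0; 0, 0, 0, 1] with hA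
  have hαcs : Real.cos α ^ 2 + Real.sin α ^ 2 = 1 := by nlinarith [Real.sin_sq_add_cos_sq α]
  have hdet : A.det = 1 := by
    have h3 : (Fin.succAbove (1 : Fin 4) (2 : Fin 3)) = 3 := by decide
    rw [hA, Matrix.det_succ_row_zero]
    simp [Fin.sum_univ_succ, Matrix.det_fin_three, h3]
    nlinarith [hαcs]
  have hAa : ∀ i j, IsAlgebraic ℚ (A i j) := by
    intro i j
    fin_cases i <;> fin_cases j <;> simp [hA] <;>
      first | exact isAlgebraic_zero | exact isAlgebraic_one | exact hc | exact hs | exact hs.neg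
  have hm0 : ∀ x : Fin 4 → ℝ, (A.mulVec x + 0) 0 = Real.cos α * x 0 + Real.sin α * x 1 := fun x => by
    simp [hA, dotProduct, Fin.sum_univ_four]
  have hm1 : ∀ x : Fin 4 → ℝ, (A.mulVec x + 0) 1 = -Real.sin α * x 0 + Real.cos α * x 1 := fun x => by
    simp [hA, dotProduct, Fin.sum_univ_four]
  have hm23 : ∀ x : Fin 4 → ℝ, (A.mulVec x + 0) 2 = x 2 ∧ (A.mulVec x + 0) 3 = x 3 := fun x => by
    constructor <;> simp [hA, dotProduct, Fin.sum_univ_four]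
  obtain ⟨q, hqd, hqi, hrq⟩ := AffineEngine.exists_pullback A 0 hAa (fun _ => isAlgebraic_zero)
    (by rw [hdet]; exact one_ne_zero) r
  have key : ∀ x : Fin 4 → ℝ, Real.sin (α + β) * x 0 - Real.cos (α + β) * x 1 =
      Real.sin β * (Real.cos α * x 0 + Real.sin α * x 1) -
        Real.cos β * (-Real.sin α * x 0 + Real.cos α * x 1) := fun x => by
    rw [Real.sin_add, Real.cos_add]; ring
  have hqd' : q.domain = {v | 0 ≤ Real.cos α * v 1 - Real.sin α * v 0 ∧
      0 ≤ Real.sin (α + β) * v 0 - Real.cos (α + β) * v 1} ∩ σ := by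
    rw [hqd]
    ext x
    rw [mem_setOf_eq, hr]
    simp only [mem_inter_iff, mem_setOf_eq, hm0, hm1, key x]
    constructor
    · rintro ⟨⟨h1, h2⟩, hσ⟩
      exact ⟨⟨by linarith, h2⟩, hrot _ hσ (Real.cos α) (Real.sin α) hαcs x
        (by rw [hm0, hm1]; linear_combination (-(x 0)) * hαcs)
        (by rw [hm0, hm1]; linear_combination (-(x 1)) * hαcs) (hm23 _).1.symm (hm23 _).2.symm⟩
    · rintro ⟨⟨h1, h2⟩, hx⟩
      exact ⟨⟨by linarith, h2⟩, hrot x hx (Real.cos α) (-Real.sin α) (by rw [neg_sq]; exact hαcs) _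
        (by rw [hm0]; ring) (hm1 _) (hm23 _).1 (hm23 _).2⟩
  refine ⟨q, hqd', fun v hv => ?_, hrq⟩
  have hv' : A.mulVec v + 0 ∈ r.domain := by rw [hqd] at hv; exact hv
  rw [hqi]
  simp only [hdet, abs_one, one_mul, hr1 _ hv']

/-! ## Filling sectors with rotated wedges -/

/-- **`m` wedges of angle `θ` make the wedge of angle `mθ ≤ π`.** For `σ ⊆ ℝ⁴` invariant under the
rotations of the plane `(v 0, v 1)`, `θ > 0` with all `cos kθ`, `sin kθ` real-algebraic, and
`r = [W_θ ∩ σ, 1]`: `m • [r] − [W_{mθ} ∩ σ, 1] ∈ KZ.relations` whenever `1 ≤ m`, `mθ ≤ π` — split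
`W_{(m+1)θ}` along the null wall of direction `mθ` into `W_{mθ}` and `W_{mθ,(m+1)θ} ≡ W_θ` (rules (1),
(2); the angular bookkeeping is `sin θ = sin (m+1)θ · cos mθ − cos (m+1)θ · sin mθ` with `sin mθ > 0`,
`sin θ > 0`, `sin (m+1)θ ≥ 0`). [cite: KontsevichZagier2001, §1.2 rules (1), (2)] -/
theorem wedge_nsmul {σ : Set (Fin 4 → ℝ)}
    (hrot : ∀ v ∈ σ, ∀ c s : ℝ, c ^ 2 + s ^ 2 = 1 → ∀ w : Fin 4 → ℝ,
      w 0 = c * v 0 - s * v 1 → w 1 = s * v 0 + c * v 1 → w 2 = v 2 → w 3 = v 3 → w ∈ σ)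
    {θ : ℝ} (hθ : 0 < θ)
    (halg : ∀ k : ℕ, IsAlgebraic ℚ (Real.cos (k * θ)) ∧ IsAlgebraic ℚ (Real.sin (k * θ)))
    {r : KZ.IntegralRep 4}
    (hr : r.domain = {v | 0 ≤ v 1 ∧ 0 ≤ Real.sin θ * v 0 - Real.cos θ * v 1} ∩ σ)
    (hr1 : ∀ v ∈ r.domain, r.integrand v = 1) :
    ∀ m : ℕ, 1 ≤ m → (m : ℝ) * θ ≤ Real.pi → ∀ R : KZ.IntegralRep 4,
      R.domain = {v | 0 ≤ v 1 ∧ 0 ≤ Real.sin (m * θ) * v 0 - Real.cos (m * θ) * v 1} ∩ σ →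
      (∀ v ∈ R.domain, R.integrand v = 1) → m • KZ.of r - KZ.of R ∈ KZ.relations := by
  intro m hm
  induction m, hm using Nat.le_induction with
  | base =>
    intro _ R hR hR1
    rw [one_nsmul]
    refine KZ.of_sub_of_mem_relations_of_eqOn (by rw [hR, hr]; simp) fun v hv => ?_
    rw [hr1 v hv, hR1 v (by rw [hR]; rw [hr] at hv; simpa using hv)]
  | succ m hm ih =>
    intro hmθ R hR hR1
    have e1 : ((m + 1 : ℕ) : ℝ) * θ = m * θ + θ := by push_cast; ring
    rw [e1] at hmθ hR
    -- signs of the sines, and the sine subtraction formula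
    have hm0 : (0 : ℝ) < m := Nat.cast_pos.mpr hm
    have hmθ' : (m : ℝ) * θ < Real.pi := by linarith
    have hsinm : 0 < Real.sin (m * θ) := Real.sin_pos_of_pos_of_lt_pi (by positivity) hmθ'
    have h1m : (1 : ℝ) ≤ m := by exact_mod_cast hm
    have hsinθ : 0 < Real.sin θ := Real.sin_pos_of_pos_of_lt_pi hθ (by nlinarith)
    have hsin1 : 0 ≤ Real.sin (m * θ + θ) :=
      Real.sin_nonneg_of_nonneg_of_le_pi (by positivity) hmθ
    have key : Real.sin θ = Real.sin (m * θ + θ) * Real.cos (m * θ) -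
        Real.cos (m * θ + θ) * Real.sin (m * θ) := by
      rw [← Real.sin_sub, add_sub_cancel_left]
    have tri₁ : ∀ v : Fin 4 → ℝ, 0 ≤ v 1 → 0 ≤ Real.sin (m * θ) * v 0 - Real.cos (m * θ) * v 1 →
        0 ≤ Real.sin (m * θ + θ) * v 0 - Real.cos (m * θ + θ) * v 1 := fun v h1 h3 => by
      have e : Real.sin (m * θ) * (Real.sin (m * θ + θ) * v 0 - Real.cos (m * θ + θ) * v 1) =
          Real.sin θ * v 1 +
            Real.sin (m * θ + θ) * (Real.sin (m * θ) * v 0 - Real.cos (m * θ) * v 1) := by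
        rw [key]; ring
      nlinarith [mul_nonneg hsinθ.le h1, mul_nonneg hsin1 h3]
    have tri₂ : ∀ v : Fin 4 → ℝ, 0 ≤ Real.cos (m * θ) * v 1 - Real.sin (m * θ) * v 0 →
        0 ≤ Real.sin (m * θ + θ) * v 0 - Real.cos (m * θ + θ) * v 1 → 0 ≤ v 1 := fun v h3 h2 => by
      have e : Real.sin θ * v 1 =
          Real.sin (m * θ) * (Real.sin (m * θ + θ) * v 0 - Real.cos (m * θ + θ) * v 1) +
            Real.sin (m * θ + θ) * (Real.cos (m * θ) * v 1 - Real.sin (m * θ) * v 0) := by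
        rw [key]; ring
      nlinarith [mul_nonneg hsinm.le h2, mul_nonneg hsin1 h3]
    -- split `R` along the wall of direction `mθ` (rule (1))
    obtain ⟨R₁, R₂, h₁d, h₁i, h₂d, h₂i, hsplit⟩ := exists_split (halg m).1 (halg m).2 R
    have h₁d' : R₁.domain =
        {v | 0 ≤ v 1 ∧ 0 ≤ Real.sin (m * θ) * v 0 - Real.cos (m * θ) * v 1} ∩ σ := by
      rw [h₁d, hR]
      ext v
      simp only [mem_setOf_eq, mem_inter_iff]
      exact ⟨fun ⟨⟨⟨h1, _⟩, hσ⟩, h3⟩ => ⟨⟨h1, h3⟩, hσ⟩,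
        fun ⟨⟨h1, h3⟩, hσ⟩ => ⟨⟨⟨h1, tri₁ v h1 h3⟩, hσ⟩, h3⟩⟩
    have h₂d' : R₂.domain = {v | 0 ≤ Real.cos (m * θ) * v 1 - Real.sin (m * θ) * v 0 ∧
        0 ≤ Real.sin (m * θ + θ) * v 0 - Real.cos (m * θ + θ) * v 1} ∩ σ := by
      rw [h₂d, hR]
      ext v
      simp only [mem_setOf_eq, mem_inter_iff]
      exact ⟨fun ⟨⟨⟨_, h2⟩, hσ⟩, h3⟩ => ⟨⟨h3, h2⟩, hσ⟩,
        fun ⟨⟨h3, h2⟩, hσ⟩ => ⟨⟨⟨tri₂ v h3 h2, h2⟩, hσ⟩, h3⟩⟩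
    -- the induction hypothesis on `R₁`, the rotation step on `R₂` (rule (2))
    have ih₁ : m • KZ.of r - KZ.of R₁ ∈ KZ.relations :=
      ih hmθ'.le R₁ h₁d' fun v hv => by
        rw [h₁i]
        exact hR1 v (by rw [h₁d] at hv; exact hv.1)
    obtain ⟨q, hqd, hq1, hrq⟩ := exists_rotate hrot (β := θ) (halg m).1 (halg m).2 r hr hr1
    have hq₂ : KZ.of q - KZ.of R₂ ∈ KZ.relations :=
      KZ.of_sub_of_mem_relations_of_eqOn (by rw [h₂d', hqd]) fun v hv => by
        rw [hq1 v hv, h₂i]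
        refine (hR1 v ?_).symm
        have hv' : v ∈ R₂.domain := by rw [h₂d', ← hqd]; exact hv
        rw [h₂d] at hv'
        exact hv'.1
    have : (m + 1) • KZ.of r - KZ.of R = (m • KZ.of r - KZ.of R₁) + (KZ.of r - KZ.of q) +
        (KZ.of q - KZ.of R₂) - (KZ.of R - KZ.of R₁ - KZ.of R₂) := by
      rw [succ_nsmul]; abel
    rw [this]
    exact KZ.relations.sub_mem (KZ.relations.add_mem (KZ.relations.add_mem ih₁ hrq) hq₂) hsplit

/-- **`2n` wedges of angle `θ = π / n` make the plane.** With `σ = t.domain ⊆ ℝ⁴` invariant under the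
rotations of the plane `(v 0, v 1)`, `r = [W_θ ∩ σ, 1]` and `t = [σ, 1]`: `2n • [r] − [t] ∈ KZ.relations`
— `σ` splits along the null wall `{v 1 = 0}` into two halves (rule (1)), the upper half
`{0 ≤ v 1} ∩ σ = W_{nθ} ∩ σ` is `n` wedges (`wedge_nsmul`), and the lower half is the rotation by `π`
of the upper one (rule (2), `exists_rotate`). [cite: KontsevichZagier2001, §1.2 rules (1), (2)] -/
theorem sector_nsmul {θ : ℝ} {n : ℕ} (hn : 1 ≤ n) (hnθ : (n : ℝ) * θ = Real.pi)
    (halg : ∀ k : ℕ, IsAlgebraic ℚ (Real.cos (k * θ)) ∧ IsAlgebraic ℚ (Real.sin (k * θ)))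
    (r t : KZ.IntegralRep 4)
    (hrot : ∀ v ∈ t.domain, ∀ c s : ℝ, c ^ 2 + s ^ 2 = 1 → ∀ w : Fin 4 → ℝ,
      w 0 = c * v 0 - s * v 1 → w 1 = s * v 0 + c * v 1 → w 2 = v 2 → w 3 = v 3 → w ∈ t.domain)
    (hr : r.domain = {v | 0 ≤ v 1 ∧ 0 ≤ Real.sin θ * v 0 - Real.cos θ * v 1} ∩ t.domain)
    (hr1 : ∀ v ∈ r.domain, r.integrand v = 1) (ht1 : ∀ v ∈ t.domain, t.integrand v = 1) :
    (2 * n) • KZ.of r - KZ.of t ∈ KZ.relations := by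
  have hθ : 0 < θ := by
    have h : 0 < (n : ℝ) * θ := by rw [hnθ]; exact Real.pi_pos
    exact pos_of_mul_pos_right h (Nat.cast_pos.mpr hn).le
  have hcπ : IsAlgebraic ℚ (Real.cos Real.pi) := by rw [Real.cos_pi]; exact isAlgebraic_one.neg
  have hsπ : IsAlgebraic ℚ (Real.sin Real.pi) := by rw [Real.sin_pi]; exact isAlgebraic_zero
  -- the two half-spaces (rule (1) along the wall `{v 1 = 0}`)
  obtain ⟨hp, hm, hpd, hpi, hmd, hmi, hsplit⟩ := exists_split hcπ hsπ t
  have hp1 : ∀ v ∈ hp.domain, hp.integrand v = 1 := fun v hv => by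
    rw [hpi]
    exact ht1 v (by rw [hpd] at hv; exact hv.1)
  have hpd' : hp.domain =
      {v | 0 ≤ v 1 ∧ 0 ≤ Real.sin Real.pi * v 0 - Real.cos Real.pi * v 1} ∩ t.domain := by
    rw [hpd]
    ext v
    simp only [mem_setOf_eq, mem_inter_iff, Real.sin_pi, Real.cos_pi, zero_mul, zero_sub, neg_mul,
      one_mul, neg_neg, and_self]
    exact and_comm
  -- `n` wedges make the upper half-space
  have hup : n • KZ.of r - KZ.of hp ∈ KZ.relations :=
    wedge_nsmul hrot hθ halg hr hr1 n hn hnθ.le hp (by rw [hpd', hnθ]) hp1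
  -- the lower half-space is the rotation by `π` of the upper one (rule (2))
  obtain ⟨q, hqd, hq1, hpq⟩ := exists_rotate hrot (β := Real.pi) hcπ hsπ hp hpd' hp1
  have hqm : KZ.of q - KZ.of hm ∈ KZ.relations := by
    refine KZ.of_sub_of_mem_relations_of_eqOn ?_ fun v hv => ?_
    · rw [hmd, hqd]
      ext v
      simp only [mem_setOf_eq, mem_inter_iff, Real.sin_add_pi, Real.cos_add_pi, Real.sin_pi,
        Real.cos_pi, zero_mul, sub_zero, neg_mul, one_mul, neg_neg, neg_zero, zero_sub, and_self]
      exact and_comm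
    · rw [hq1 v hv, hmi]
      refine (ht1 v ?_).symm
      rw [hqd] at hv
      exact hv.2
  have : (2 * n) • KZ.of r - KZ.of t = 2 • (n • KZ.of r - KZ.of hp) + (KZ.of hp - KZ.of q) +
      (KZ.of q - KZ.of hm) - (KZ.of t - KZ.of hp - KZ.of hm) := by
    rw [mul_nsmul']; abel
  rw [this]
  exact KZ.relations.sub_mem (KZ.relations.add_mem (KZ.relations.add_mem
    (KZ.relations.nsmul_mem hup 2) hpq) hqm) hsplit

end CoxeterChamber

open CoxeterChamber in
/-- **COXETER CHAMBER TILING** (item stmt-KontsevichZagierPeriods-3818 of route `SphericalSchlafli`,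
stub of line `Sketch`). With `W = {(p, q) | 0 ≤ q, 0 ≤ sin(π/9)·p − cos(π/9)·q}` the closed wedge of
angle `π/9` and `B⁴` the closed unit ball of `ℝ⁴ = ℝ² × ℝ²`: for honest representations
`r = [B⁴ ∩ (W × W), 1]`, `b = [B⁴, 1]` one has `324 • [r] − [b] ∈ KZ.relations` — the sector count
`18 • [W ∩ σ, 1] ≡ [σ, 1]` (`sector_nsmul`) for `σ = B⁴ ∩ (ℝ² × W)` in the plane `(v 0, v 1)`, the
coordinate swap `(v 0, v 1, v 2, v 3) ↦ (v 2, v 3, v 0, v 1)` (`KZ.of_sub_of_reindex_mem_relations`),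
and the sector count for `σ = B⁴`; `324 = 18 · 18`. [cite: KontsevichZagier2001, §1.2 rules (1), (2)] -/
theorem tateLifting_coxeterChamberTiling :
    ∀ (r b : KZ.IntegralRep 4), r.domain = {v | 0 ≤ v 1 ∧ 0 ≤ Real.sin (Real.pi / 9) * v 0 - Real.cos (Real.pi / 9) * v 1 ∧ 0 ≤ v 3 ∧ 0 ≤ Real.sin (Real.pi / 9) * v 2 - Real.cos (Real.pi / 9) * v 3 ∧ ∑ j, v j ^ 2 ≤ 1} → (∀ v ∈ r.domain, r.integrand v = 1) → b.domain = {v | ∑ j, v j ^ 2 ≤ 1} → (∀ v ∈ b.domain, b.integrand v = 1) → (324 : ℕ) • KZ.of r - KZ.of b ∈ KZ.relations := by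
  intro r b hr hr1 hb hb1
  -- `cos (kπ/9)`, `sin (kπ/9)` are real-algebraic
  have halg : ∀ k : ℕ, IsAlgebraic ℚ (Real.cos (k * (Real.pi / 9))) ∧
      IsAlgebraic ℚ (Real.sin (k * (Real.pi / 9))) := fun k => by
    have e : Real.pi * k / ((9 : ℕ) : ℝ) = k * (Real.pi / 9) := by push_cast; ring
    exact ⟨e ▸ KoblitzOgus.isAlgebraic_cos_rat_mul_pi k (b := 9) (by norm_num),
      e ▸ KoblitzOgus.isAlgebraic_sin_rat_mul_pi k (b := 9) (by norm_num)⟩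
  have h9 : ((9 : ℕ) : ℝ) * (Real.pi / 9) = Real.pi := by push_cast; ring
  have hc : IsAlgebraic ℚ (Real.cos (Real.pi / 9)) := by simpa using (halg 1).1
  have hs : IsAlgebraic ℚ (Real.sin (Real.pi / 9)) := by simpa using (halg 1).2
  -- a rotation of the plane `(v 0, v 1)` preserves `|v|²`
  have hsq : ∀ (v w : Fin 4 → ℝ) (c s : ℝ), c ^ 2 + s ^ 2 = 1 → w 0 = c * v 0 - s * v 1 →
      w 1 = s * v 0 + c * v 1 → w 2 = v 2 → w 3 = v 3 → ∑ j, w j ^ 2 = ∑ j, v j ^ 2 := by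
    intro v w c s hcs h0 h1 h2 h3
    simp only [Fin.sum_univ_four, h0, h1, h2, h3]
    linear_combination (v 0 ^ 2 + v 1 ^ 2) * hcs
  have hrotB : ∀ v ∈ b.domain, ∀ c s : ℝ, c ^ 2 + s ^ 2 = 1 → ∀ w : Fin 4 → ℝ,
      w 0 = c * v 0 - s * v 1 → w 1 = s * v 0 + c * v 1 → w 2 = v 2 → w 3 = v 3 →
      w ∈ b.domain := fun v hv c s hcs w h0 h1 h2 h3 => by
    rw [hb, mem_setOf_eq] at hv ⊢
    rwa [hsq v w c s hcs h0 h1 h2 h3]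
  -- `t₂ = [B⁴ ∩ (W × ℝ²), 1]`, an honest restriction of `b`; the sector count for `σ = B⁴`
  obtain ⟨-, t₀, -, -, ht₀d, ht₀i, -⟩ := exists_split (γ := 0)
    (by rw [Real.cos_zero]; exact isAlgebraic_one) (by rw [Real.sin_zero]; exact isAlgebraic_zero) b
  obtain ⟨t₂, -, ht₂d, ht₂i, -, -, -⟩ := exists_split hc hs t₀
  replace ht₂d : t₂.domain = {v | 0 ≤ v 1 ∧
      0 ≤ Real.sin (Real.pi / 9) * v 0 - Real.cos (Real.pi / 9) * v 1} ∩ b.domain := by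
    rw [ht₂d, ht₀d]
    ext v
    simp only [mem_setOf_eq, mem_inter_iff, Real.sin_zero, Real.cos_zero, zero_mul, one_mul, sub_zero]
    tauto
  have ht₂1 : ∀ v ∈ t₂.domain, t₂.integrand v = 1 := fun v hv => by
    rw [ht₂i, ht₀i]
    exact hb1 v (by rw [ht₂d] at hv; exact hv.2)
  have h₂ : (2 * 9) • KZ.of t₂ - KZ.of b ∈ KZ.relations :=
    sector_nsmul (by norm_num) h9 halg t₂ b hrotB ht₂d ht₂1 hb1
  -- `t₁ = [B⁴ ∩ (ℝ² × W), 1]`, the coordinate swap of `t₂`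
  set e : Fin 4 ≃ Fin 4 := (Equiv.swap (0 : Fin 4) 2).trans (Equiv.swap 1 3)
  obtain ⟨he0, he1, he2, he3⟩ : e 0 = 2 ∧ e 1 = 3 ∧ e 2 = 0 ∧ e 3 = 1 := by decide
  have ht₁d : (t₂.reindex e).domain = {w | 0 ≤ w 3 ∧
      0 ≤ Real.sin (Real.pi / 9) * w 2 - Real.cos (Real.pi / 9) * w 3 ∧ ∑ j, w j ^ 2 ≤ 1} := by
    ext w
    simp only [KZ.IntegralRep.reindex_domain, ht₂d, hb, mem_setOf_eq, mem_inter_iff, he0, he1, he2,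
      he3, Fin.sum_univ_four]
    exact ⟨fun ⟨⟨h1, h2⟩, h3⟩ => ⟨h1, h2, by linarith⟩, fun ⟨h1, h2, h3⟩ => ⟨⟨h1, h2⟩, by linarith⟩⟩
  have ht₁1 : ∀ w ∈ (t₂.reindex e).domain, (t₂.reindex e).integrand w = 1 := fun w hw => by
    rw [KZ.IntegralRep.reindex_integrand]
    exact ht₂1 _ hw
  -- `B⁴ ∩ (ℝ² × W)` is invariant under the rotations of the plane `(v 0, v 1)`
  have hrot₁ : ∀ v ∈ (t₂.reindex e).domain, ∀ c s : ℝ, c ^ 2 + s ^ 2 = 1 → ∀ w : Fin 4 → ℝ,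
      w 0 = c * v 0 - s * v 1 → w 1 = s * v 0 + c * v 1 → w 2 = v 2 → w 3 = v 3 →
      w ∈ (t₂.reindex e).domain := fun v hv c s hcs w h0 h1 h2 h3 => by
    rw [ht₁d, mem_setOf_eq] at hv ⊢
    rw [hsq v w c s hcs h0 h1 h2 h3, h2, h3]
    exact hv
  -- the sector count for `σ = B⁴ ∩ (ℝ² × W)`: the chamber is `(W × ℝ²) ∩ σ`
  have hr' : r.domain = {v | 0 ≤ v 1 ∧ 0 ≤ Real.sin (Real.pi / 9) * v 0 - Real.cos (Real.pi / 9) * v 1} ∩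
      (t₂.reindex e).domain := by
    rw [hr, ht₁d]
    ext v
    simp only [mem_setOf_eq, mem_inter_iff]
    tauto
  have h₁ : (2 * 9) • KZ.of r - KZ.of (t₂.reindex e) ∈ KZ.relations :=
    sector_nsmul (by norm_num) h9 halg r (t₂.reindex e) hrot₁ hr' hr1 ht₁1
  have : (324 : ℕ) • KZ.of r - KZ.of b = 18 • ((2 * 9) • KZ.of r - KZ.of (t₂.reindex e)) -
      18 • (KZ.of t₂ - KZ.of (t₂.reindex e)) + ((2 * 9) • KZ.of t₂ - KZ.of b) := by
    abel
  rw [this]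
  exact KZ.relations.add_mem (KZ.relations.sub_mem (KZ.relations.nsmul_mem h₁ 18)
    (KZ.relations.nsmul_mem (KZ.of_sub_of_reindex_mem_relations t₂ e) 18)) h₂

end Summit.KontsevichZagierPeriods.InverseLandau

end
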